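import Mathlib
import HarnessLib
import Summits.HubbardSuperconductivity.HubbardSuperconductivity.Theorems.KLProgrammeAbsUmklappTargetCountUniform
import Summits.HubbardSuperconductivity.HubbardSuperconductivity.Theorems.KLProgrammeH10TwoPointLimitFrameBGM2003SectorCountingUniform

/-!
# Route `KLProgramme` — K3 engine (stmt-HubbardSuperconductivity-20437), stub (b) (ℓ)/(I2)–(I3), located item «ABS-UMK-COUNT»:
# the anchored absolute `(L−3)` count of target strings ON THE CURVE OF EVERY FRAME of small `C²` size / EVERY ADMISSIBLE FRAME, one set of constants

Cell gate-hubbard-kl, seat p4 g15 (frame dischargers; twin of `frame_bgm2003_sectorCounting_uniform` / `frameOK_…` for the umklapp/target count).  The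
δ-uniform theorem `targetStrings_perturbed_uniform` is run at the extreme sizes `κ₀ = A₀`, `κ₁ = 2A₀`, `κ₂ = 4A₀`, `A₀ = κ/4`, of a level window
`[μ₁, μ₂] ⊂ (−4, 0)` (band constants `bandBounds`, shell `e₀ = m₀/4`, convexity margin verbatim as in `dispersionHyp_frame`), and then on every admissible
frame of the KL regime through `frame_thresholds` / `norm_iteratedFDeriv_frameShift_le_of_frameOK_regime`:

* **`frame_targetStrings_uniform`** — for every window: `∃ e₀ κ` and the thirteen constants of `targetStrings_perturbed_uniform` such that for EVERY frame
  `K` of `C²` size `A`, `4A ≤ κ`, and EVERY `μ ∈ [μ₁, μ₂]` the bound of `card_targetStrings_le` holds for the frame curve's target strings (regime verbatim);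
* **`frameOK_targetStrings_uniform`** — the same ON EVERY ADMISSIBLE FRAME IN THE KL REGIME, constants chosen before `R, U, β, μ, ν, K`.

Everything is PROVED by composition; no definitions, no named facts. [cite: BenfattoGiulianiMastropietro2003, §3.1 Lemma 3.1 and §7.4]
[cite: BenfattoGiulianiMastropietro2006, §2.4 Lemma 2.1, App. A3]
-/

noncomputable section

namespace Summit.HubbardSuperconductivity.HubbardSuperconductivity.Theorems.PerturbedFermiCurve

set_option linter.dupNamespace false -- summit = problem name (single-conjunct summit), D-0017

open Real Set
open Literature.MathematicalPhysics.QuantumLattice Literature.MathematicalPhysics.QuantumLattice.BandSectorCounting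
open Literature.MathematicalPhysics.QuantumLattice.FermiRG Literature.MathematicalPhysics.QuantumLattice.FermiRG.BGM2003
open Summit.HubbardSuperconductivity.HubbardSuperconductivity.Theorems.DispersionFlow
open Summit.HubbardSuperconductivity.HubbardSuperconductivity.Theorems.KLRegimeSplit

/-! ## §1 On the curve of every frame of small `C²` size -/

set_option maxHeartbeats 800000 in -- the convexity-margin arithmetic at the extreme sizes plus the thirteen-constant conclusion
/-- **The anchored absolute target count ON THE CURVES OF ALL FRAMES of small `C²` size, ONE set of constants** (see the module docstring).
[cite: BenfattoGiulianiMastropietro2003, §3.1 Lemma 3.1 (4.3) and §7.4] -/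
theorem frame_targetStrings_uniform :
    ∀ μ₁ μ₂ : ℝ, -4 < μ₁ → μ₁ ≤ μ₂ → μ₂ < 0 → ∃ e₀ : ℝ, 0 < e₀ ∧ ∃ κ : ℝ, 0 < κ ∧
      ∃ c₂ c₃ K₁ K₂ c₀ c₂' η₀ s₁ Φ cf Af Bf M₁ : ℝ,
      0 ≤ c₂ ∧ 0 < c₃ ∧ 0 ≤ K₁ ∧ K₂ = K₁ * π + 4 ∧ 2 + c₂ ≤ K₁ ∧ 0 < c₀ ∧ 0 < c₂' ∧ 0 < η₀ ∧
      0 < s₁ ∧ 0 ≤ M₁ ∧ 0 < Φ ∧ 0 < cf ∧ cf ≤ Af ∧ 0 ≤ Bf ∧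
      ∀ (K : TrigPolyC4v) (A : ℝ), (∀ p : Momentum, ∀ j ≤ 2, ‖iteratedFDeriv ℝ j (frameShift K) p‖ ≤ A) → 4 * A ≤ κ →
      ∀ μ ∈ Set.Icc μ₁ μ₂,
        ∀ (n' L : ℕ), 6 ≤ L → ∀ (i₁ : Fin L) (ω₁ : ℕ), ω₁ < sectorCount n' → ∀ (R : Fin 2 → ℝ) (Φ₀ LΨ Bfib : ℝ),
          0 ≤ Φ₀ → 2 * Φ₀ ≤ Φ → LΨ = L + c₂ * (π / 2) / (K₁ * Φ₀) → (2 : ℝ) ^ (-(n' : ℤ)) ≤ Φ₀ → c₃ * (2 : ℝ) ^ (-(n' : ℤ)) ≤ Φ₀ →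
          K₂ * LΨ * (c₃ * (2 : ℝ) ^ (-(n' : ℤ))) ≤ c₂' * Φ₀ →
          max ((2 * ((2 * c₀ * K₂ * c₃ / π + 1) * LΨ)) ^ 2) (4 * c₃ ^ 2 * K₂ ^ 2 / η₀ ^ 2 * LΨ ^ 2) ≤ Bfib →
          6 * (M₁ * (2 * Φ₀)) + 3 * (L * (4 * c₃ * (2 : ℝ) ^ (-(n' : ℤ)))) + 2 * (s₁ / 2 * sectorWidth n') ≤ s₁ / 4 * Φ →
          (Nat.card {ω : Fin L → Fin (sectorCount n') |
              (ω i₁ : ℕ) = ω₁ ∧ ∃ k : Fin L → (Fin 2 → ℝ),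
                (∀ i, k i ∈ BGM2003.sSector
                  (fun ϑ e => perturbedFermiRadius (fun k : Fin 2 → ℝ => frameShift K (WithLp.toLp 2 k)) (μ + e) ϑ) e₀ n' (ω i : ℕ)) ∧
                ∑ i, k i = R} : ℝ) ≤
            2 * (L : ℝ) ^ 4 *
              ((2 * (L * (4 * c₃ * (2 : ℝ) ^ (-(n' : ℤ)))) / (s₁ / 2 * sectorWidth n') + 1) *
                (960 * Af * (2 * (L * (4 * c₃ * (2 : ℝ) ^ (-(n' : ℤ))) + Bf * (L * (4 * c₃ * (2 : ℝ) ^ (-(n' : ℤ))))) +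
                  (4 * Bf + 1) * (s₁ / 2 * sectorWidth n')) / cf ^ 2 / (s₁ / 2 * sectorWidth n') ^ 2) *
              ((sectorCount n' : ℝ) * (2 * (2 * Φ₀ / sectorWidth n' + 1)) ^ (L - 5))) +
            (L : ℝ) ^ 2 * 2 ^ L * (L ^ 2 * (Bfib * (3 * (2 : ℝ) ^ n') ^ (L - 3))) := by
  intro μ₁ μ₂ hμ₁ h12 hμ₂
  have ha : -4 < (μ₁ - 4) / 2 := by linarith
  have hab : (μ₁ - 4) / 2 ≤ μ₂ / 2 := by linarith
  have hb : μ₂ / 2 < 0 := by linarith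
  obtain ⟨B, -⟩ : ∃ B : BandBounds ((μ₁ - 4) / 2) (μ₂ / 2), B = bandBounds ha hab hb := ⟨_, rfl⟩
  obtain ⟨m₀, hm₀def⟩ : ∃ m₀ : ℝ, m₀ = min (μ₁ - (μ₁ - 4) / 2) (μ₂ / 2 - μ₂) := ⟨_, rfl⟩
  have hm₀ : 0 < m₀ := by rw [hm₀def]; exact lt_min (by linarith) (by linarith)
  have hm1 : m₀ ≤ μ₁ - (μ₁ - 4) / 2 := by rw [hm₀def]; exact min_le_left _ _
  have hm2 : m₀ ≤ μ₂ / 2 - μ₂ := by rw [hm₀def]; exact min_le_right _ _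
  have hDt := B.Dtmin_pos; have hs := B.smax_pos; have hh := B.hmin_pos; have hπ := Real.pi_pos
  -- the uniform majorants of `K_V`, `S_E` (as in `dispersionHyp_frame`)
  obtain ⟨c₁, hc₁⟩ : ∃ c₁ : ℝ, c₁ = π * Real.sqrt 2 + 2 * B.smax := ⟨_, rfl⟩
  have hc₁0 : 0 < c₁ := by rw [hc₁]; positivity
  obtain ⟨cV, hcV⟩ : ∃ cV : ℝ, cV = 2 * c₁ / B.Dtmin := ⟨_, rfl⟩
  have hcV0 : 0 < cV := by rw [hcV]; positivity
  obtain ⟨SEm, hSEm⟩ : ∃ SEm : ℝ, SEm = B.smax + c₁ := ⟨_, rfl⟩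
  have hSEm0 : 0 < SEm := by rw [hSEm]; positivity
  obtain ⟨κ, hκdef⟩ : ∃ κ : ℝ, κ = min B.Dtmin (min m₀ (B.hmin / (4 * cV * (SEm + B.smax) + SEm ^ 2))) := ⟨_, rfl⟩
  have hκ0 : 0 < κ := by rw [hκdef]; exact lt_min hDt (lt_min hm₀ (by positivity))
  have hκD : κ ≤ B.Dtmin := by rw [hκdef]; exact min_le_left _ _
  have hκm : κ ≤ m₀ := by rw [hκdef]; exact (min_le_right _ _).trans (min_le_left _ _)
  have hκh : κ ≤ B.hmin / (4 * cV * (SEm + B.smax) + SEm ^ 2) := by rw [hκdef]; exact (min_le_right _ _).trans (min_le_right _ _)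
  -- the extreme sizes `A₀ = κ/4`: `κ₀ = A₀`, `κ₁ = 2A₀`, `κ₂ = 4A₀`
  obtain ⟨A, hAdef⟩ : ∃ A : ℝ, A = κ / 4 := ⟨_, rfl⟩
  have hA0 : 0 ≤ A := by rw [hAdef]; positivity
  have hAκ : 4 * A ≤ κ := by rw [hAdef]; linarith
  have h2κ₁ : 2 * (2 * A) ≤ B.Dtmin := by linarith
  -- the convexity margin at the extreme sizes (verbatim the computation of `dispersionHyp_frame`)
  have hden : B.Dtmin / 2 ≤ B.Dtmin - 2 * A := by linarith
  have hden0 : 0 < B.Dtmin - 2 * A := by linarith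
  have hKV : 2 * A * (π * Real.sqrt 2 + 2 * B.smax) / (B.Dtmin - 2 * A) ≤ cV * (2 * A) := by
    rw [← hc₁, hcV, div_le_iff₀ hden0]
    have e : 2 * c₁ / B.Dtmin * (2 * A) * (B.Dtmin - 2 * A) = 2 * A * c₁ * (2 * (B.Dtmin - 2 * A) / B.Dtmin) := by
      field_simp
    rw [e]
    have h1 : 1 ≤ 2 * (B.Dtmin - 2 * A) / B.Dtmin := by rw [le_div_iff₀ hDt]; linarith
    have h0 : 0 ≤ 2 * A * c₁ := by positivity
    nlinarith
  have hKV0 : 0 ≤ 2 * A * (π * Real.sqrt 2 + 2 * B.smax) / (B.Dtmin - 2 * A) := by positivity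
  have hSE : B.smax + 2 * A * (π * Real.sqrt 2 + 2 * B.smax) / (B.Dtmin - 2 * A) ≤ SEm := by
    have hKV' : 2 * A * (π * Real.sqrt 2 + 2 * B.smax) / (B.Dtmin - 2 * A) ≤ c₁ := by
      refine hKV.trans ?_
      rw [hcV]
      have : 2 * c₁ / B.Dtmin * (2 * A) = c₁ * (4 * A / B.Dtmin) := by
        field_simp
        ring
      rw [this]
      have h1 : 4 * A / B.Dtmin ≤ 1 := by rw [div_le_one hDt]; linarith
      nlinarith
    rw [hSEm]; linarith
  have hSE0 : 0 ≤ B.smax + 2 * A * (π * Real.sqrt 2 + 2 * B.smax) / (B.Dtmin - 2 * A) := by positivity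
  have hconv : B.hmin ≤ 2 * (B.hmin - 4 * (2 * A * (π * Real.sqrt 2 + 2 * B.smax) / (B.Dtmin - 2 * A)) *
        ((B.smax + 2 * A * (π * Real.sqrt 2 + 2 * B.smax) / (B.Dtmin - 2 * A)) + B.smax)) -
        4 * A * (B.smax + 2 * A * (π * Real.sqrt 2 + 2 * B.smax) / (B.Dtmin - 2 * A)) ^ 2 := by
    have h1 : 4 * (2 * A * (π * Real.sqrt 2 + 2 * B.smax) / (B.Dtmin - 2 * A)) *
        ((B.smax + 2 * A * (π * Real.sqrt 2 + 2 * B.smax) / (B.Dtmin - 2 * A)) + B.smax) ≤ 4 * (cV * (2 * A)) * (SEm + B.smax) :=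
      mul_le_mul (mul_le_mul_of_nonneg_left hKV (by norm_num)) (by linarith) (by positivity) (by positivity)
    have h2 : 4 * A * (B.smax + 2 * A * (π * Real.sqrt 2 + 2 * B.smax) / (B.Dtmin - 2 * A)) ^ 2 ≤ 4 * A * SEm ^ 2 :=
      mul_le_mul_of_nonneg_left (pow_le_pow_left₀ hSE0 hSE 2) (by positivity)
    have h3 : κ * (4 * cV * (SEm + B.smax) + SEm ^ 2) ≤ B.hmin := by
      rwa [le_div_iff₀ (by positivity)] at hκh
    have h5 : 0 ≤ 4 * cV * (SEm + B.smax) + SEm ^ 2 := by positivity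
    nlinarith [mul_le_mul_of_nonneg_right hAκ h5]
  -- the uniform count at the extreme sizes, shell `e₀ = m₀/4`
  obtain ⟨c₂, c₃, K₁, K₂, c₀, c₂', η₀, s₁, Φ, cf, Af, Bf, M₁, hc₂, hc₃, hK₁0, hK₂, hK₁c, hc₀, hc₂', hη₀, hs₁, hM₁, hΦ, hcf, hcfA, hBf, hcount⟩ :=
    targetStrings_perturbed_uniform B (κ₀ := A) (e₀ := m₀ / 4) (by positivity) (by positivity : 0 ≤ 2 * A) (by positivity : 0 ≤ 4 * A) h2κ₁ hconv
  refine ⟨m₀ / 4, by positivity, κ, hκ0, c₂, c₃, K₁, K₂, c₀, c₂', η₀, s₁, Φ, cf, Af, Bf, M₁, hc₂, hc₃, hK₁0, hK₂, hK₁c, hc₀, hc₂', hη₀, hs₁, hM₁,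
    hΦ, hcf, hcfA, hBf, ?_⟩
  intro K A' hA' hA'κ μ hμ n' L hL i₁ ω₁ hω₁ R Φ₀ LΨ Bfib hΦ₀ h2Φ₀ hLΨ hΦt hΦδ hΦη hBfib hreg
  have hA'A : A' ≤ A := by rw [hAdef]; linarith
  -- the frame's perturbation obeys the extreme sizes
  have hδ : ∀ k : Fin 2 → ℝ, |frameShift K (WithLp.toLp 2 k)| ≤ A := fun k => (abs_frameShift_toLp_le hA' k).trans hA'A
  have hκ₁ : ∀ k : Fin 2 → ℝ, ‖fderiv ℝ (fun k : Fin 2 → ℝ => frameShift K (WithLp.toLp 2 k)) k‖ ≤ 2 * A :=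
    fun k => (norm_fderiv_frameShift_toLp_le hA' k).trans (by linarith)
  have hκ₂ : ∀ k : Fin 2 → ℝ, ‖fderiv ℝ (fderiv ℝ (fun k : Fin 2 → ℝ => frameShift K (WithLp.toLp 2 k))) k‖ ≤ 4 * A :=
    fun k => (norm_fderiv_fderiv_frameShift_toLp_le hA' k).trans (by linarith)
  have hlo : (μ₁ - 4) / 2 + A + 2 * (m₀ / 4) ≤ μ := by linarith [hμ.1]
  have hhi : μ + A + 2 * (m₀ / 4) ≤ μ₂ / 2 := by linarith [hμ.2]
  exact hcount _ (contDiff_frameShift_toLp K) (frameShift_toLp_neg K) hδ hκ₁ hκ₂ μ hlo hhi n' L hL i₁ ω₁ hω₁ R Φ₀ LΨ Bfib hΦ₀ h2Φ₀ hLΨ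
    hΦt hΦδ hΦη hBfib hreg

/-! ## §2 On every admissible frame in the KL regime -/

/-- **The anchored absolute target count ON EVERY ADMISSIBLE FRAME IN THE KL REGIME, one set of constants** (the shell `e₀` and the thirteen
constants depend on the window only; the thresholds `c₃′, U₀` on the renormalisation package `R`). [cite: BenfattoGiulianiMastropietro2003, §3.1 Lemma 3.1 (4.3) and §7.4] -/
theorem frameOK_targetStrings_uniform :
    ∀ μ₁ μ₂ : ℝ, -4 < μ₁ → μ₁ ≤ μ₂ → μ₂ < 0 → ∃ e₀ : ℝ, 0 < e₀ ∧
      ∃ c₂ c₃ K₁ K₂ c₀ c₂' η₀ s₁ Φ cf Af Bf M₁ : ℝ,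
      0 ≤ c₂ ∧ 0 < c₃ ∧ 0 ≤ K₁ ∧ K₂ = K₁ * π + 4 ∧ 2 + c₂ ≤ K₁ ∧ 0 < c₀ ∧ 0 < c₂' ∧ 0 < η₀ ∧
      0 < s₁ ∧ 0 ≤ M₁ ∧ 0 < Φ ∧ 0 < cf ∧ cf ≤ Af ∧ 0 ≤ Bf ∧
      ∀ R' : RenConsts, (∀ j, 0 ≤ R'.Gfr j) → ∃ c₃' : ℝ, 0 < c₃' ∧ ∃ U₀ : ℝ, 0 < U₀ ∧
      ∀ c : ℝ, 0 < c → c ≤ c₃' → ∀ U : ℝ, 0 < U → U ≤ U₀ → ∀ β : ℝ, klBetaMin ≤ β → β ≤ Real.exp (c / U ^ 2) →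
      ∀ μ ∈ Set.Icc μ₁ μ₂, ∀ (ν : ℝ) (K : TrigPolyC4v), FrameOK R' U (nScales β) ν K →
        ∀ (n' L : ℕ), 6 ≤ L → ∀ (i₁ : Fin L) (ω₁ : ℕ), ω₁ < sectorCount n' → ∀ (R : Fin 2 → ℝ) (Φ₀ LΨ Bfib : ℝ),
          0 ≤ Φ₀ → 2 * Φ₀ ≤ Φ → LΨ = L + c₂ * (π / 2) / (K₁ * Φ₀) → (2 : ℝ) ^ (-(n' : ℤ)) ≤ Φ₀ → c₃ * (2 : ℝ) ^ (-(n' : ℤ)) ≤ Φ₀ →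
          K₂ * LΨ * (c₃ * (2 : ℝ) ^ (-(n' : ℤ))) ≤ c₂' * Φ₀ →
          max ((2 * ((2 * c₀ * K₂ * c₃ / π + 1) * LΨ)) ^ 2) (4 * c₃ ^ 2 * K₂ ^ 2 / η₀ ^ 2 * LΨ ^ 2) ≤ Bfib →
          6 * (M₁ * (2 * Φ₀)) + 3 * (L * (4 * c₃ * (2 : ℝ) ^ (-(n' : ℤ)))) + 2 * (s₁ / 2 * sectorWidth n') ≤ s₁ / 4 * Φ →
          (Nat.card {ω : Fin L → Fin (sectorCount n') |
              (ω i₁ : ℕ) = ω₁ ∧ ∃ k : Fin L → (Fin 2 → ℝ),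
                (∀ i, k i ∈ BGM2003.sSector
                  (fun ϑ e => perturbedFermiRadius (fun k : Fin 2 → ℝ => frameShift K (WithLp.toLp 2 k)) (μ + e) ϑ) e₀ n' (ω i : ℕ)) ∧
                ∑ i, k i = R} : ℝ) ≤
            2 * (L : ℝ) ^ 4 *
              ((2 * (L * (4 * c₃ * (2 : ℝ) ^ (-(n' : ℤ)))) / (s₁ / 2 * sectorWidth n') + 1) *
                (960 * Af * (2 * (L * (4 * c₃ * (2 : ℝ) ^ (-(n' : ℤ))) + Bf * (L * (4 * c₃ * (2 : ℝ) ^ (-(n' : ℤ))))) +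
                  (4 * Bf + 1) * (s₁ / 2 * sectorWidth n')) / cf ^ 2 / (s₁ / 2 * sectorWidth n') ^ 2) *
              ((sectorCount n' : ℝ) * (2 * (2 * Φ₀ / sectorWidth n' + 1)) ^ (L - 5))) +
            (L : ℝ) ^ 2 * 2 ^ L * (L ^ 2 * (Bfib * (3 * (2 : ℝ) ^ n') ^ (L - 3))) := by
  intro μ₁ μ₂ hμ₁ h12 hμ₂
  obtain ⟨e₀, he₀, κ, hκ, c₂, c₃, K₁, K₂, c₀, c₂', η₀, s₁, Φ, cf, Af, Bf, M₁, hc₂, hc₃, hK₁0, hK₂, hK₁c, hc₀, hc₂', hη₀, hs₁, hM₁, hΦ, hcf,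
    hcfA, hBf, h⟩ := frame_targetStrings_uniform μ₁ μ₂ hμ₁ h12 hμ₂
  refine ⟨e₀, he₀, c₂, c₃, K₁, K₂, c₀, c₂', η₀, s₁, Φ, cf, Af, Bf, M₁, hc₂, hc₃, hK₁0, hK₂, hK₁c, hc₀, hc₂', hη₀, hs₁, hM₁, hΦ, hcf, hcfA, hBf,
    fun R' hR' => ?_⟩
  obtain ⟨c₃', hc₃', U₀, hU₀, hthr⟩ := frame_thresholds hR' hκ
  refine ⟨c₃', hc₃', U₀, hU₀, ?_⟩
  intro c hc hcle U hU hUle β hβmin hβc μ hμ ν K hK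
  exact h K _ (fun p j hj => norm_iteratedFDeriv_frameShift_le_of_frameOK_regime hR' hc.le hβmin hβc hK p hj)
    (hthr c U hc.le hcle hU hUle) μ hμ

end Summit.HubbardSuperconductivity.HubbardSuperconductivity.Theorems.PerturbedFermiCurve

end
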